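import Mathlib
import Summits.Parity.BatemanHorn.Theses.RoughValueTransport
import Literature.NumberTheory.Sieve.QuadraticRootsPrimeModuliDFI
import Literature.NumberTheory.Sieve.SieveFrameworkFundamentalLemma

/-!
# Sketch — crux-ideate stmt-Parity-9469 (BalancedSemiprimeLayer), ideator 2, round 1

First-lemma signatures for the idea cards in `Ideas/`.  Everything here must ELABORATE; the
`sorry`s mark the statements to be proved by the line, they are not claims.
-/

open Polynomial Filter
open scoped BigOperators

namespace Summit.Parity.BatemanHorn.Cruxes.BalancedSemiprimeLayer.Ideas

/-- The left-hand count of the crux for one system `f` at `x, δ`: `1 ≤ n ≤ x` with every `fᵢ(n) > 0`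
and no prime `p < x^{deg fᵢ (1−δ)/2}` dividing `fᵢ(n)` (verbatim sub-term of
`RoughValueTransport.BalancedSemiprimeLayer`). -/
noncomputable def layerCount {k : ℕ} (f : Fin k → ℤ[X]) (x : ℕ) (δ : ℝ) : ℕ :=
  ((Finset.Icc 1 x).filter (fun n : ℕ => ∀ i, 0 < (f i).eval (n : ℤ) ∧
    ∀ p ∈ Finset.range ⌈(x : ℝ) ^ (((f i).natDegree : ℝ) * (1 - δ) / 2)⌉₊,
      p.Prime → ¬ ((p : ℤ) ∣ (f i).eval (n : ℤ)))).card

/-- The crux restricted to ONE system `f` ("the boundary layer of `f` is thin"). -/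
def LayerThin {k : ℕ} (f : Fin k → ℤ[X]) : Prop :=
  ∀ ε : ℝ, 0 < ε → ∃ δ : ℝ, 0 < δ ∧ δ ≤ 1 / 4 ∧ ∀ᶠ x : ℕ in atTop,
    (layerCount f x δ : ℝ) ≤
      (Literature.NumberTheory.Sieve.polyPrimeCount f x : ℝ) + ε * (x : ℝ) / Real.log x ^ k

/-- Read-back: the crux is `∀ systems, LayerThin` (definitional). -/
theorem balancedSemiprimeLayer_iff :
    Summit.Parity.BatemanHorn.Theses.RoughValueTransport.BalancedSemiprimeLayer ↔
      ∀ (k : ℕ) (f : Fin k → ℤ[X]),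
        Literature.NumberTheory.Sieve.IsBatemanHornSystem f → LayerThin f :=
  Iff.rfl

/-! ## Card `rough-relaxed-divisor-sieve` — first lemma(s) -/

/-- **Uniform level-`e` linear forms of root Weyl sums** for a quadratic `g` (the shape of
DFI 1995 Prop. 1 / Tóth 2000 as vendored in `QuadraticRootsPrimeModuliDFI`,
`QuadraticRootsPrimeModuliTothAssembly`): a power saving in
`L_e(M) = ∑_{M < m ≤ 2M} ρ_h(e m)` uniform for `e ≤ M`, with at most polynomial loss in `e|h|`.
This is the ONLY distribution input the card needs for a single quadratic. -/
def UniformLevelLinearForms (g : ℤ[X]) : Prop :=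
  ∃ A θ K : ℝ, 0 < θ ∧ ∀ (h : ℤ) (e : ℕ) (M : ℝ), h ≠ 0 → 1 ≤ e → (e : ℝ) ≤ M →
    ‖Literature.NumberTheory.Sieve.DFI1995.linearForm g h e M‖ ≤
      K * ((|h| : ℝ) * e) ^ A * M ^ (1 - θ)

/-- **First lemma (general single quadratic).**  For an irreducible quadratic Bateman–Horn
polynomial, uniform level-`e` linear forms of its root Weyl sums imply the crux for the system
`![g]`: the balanced-semiprime layer of `g` is thin.  (Proof plan: majorant
`1_{layer} ≤ τ_W(g(n))·1_{g(n) z-rough}`, `W = [x^{1−δ}, (g(x))^{1/2}]`, `z = x^c`; the PROVED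
`SieveSequence.fundamental_lemma_uniform_holds` in dimension 2 on the `τ_W`-weighted sequence;
main term `≍ (δ/c²)·x/log x` from `∑_{m ∈ W} ρ_g(m)/m ≍ δ log x`; remainder = level-`e` linear
forms after Poisson in `n`, frequencies `|h| ≤ x^{δ+2c+o(1)}`.) -/
theorem layerThin_of_uniformLevelLinearForms (g : ℤ[X]) (hdeg : g.natDegree = 2)
    (hg : Literature.NumberTheory.Sieve.IsBatemanHornSystem ![g])
    (H : UniformLevelLinearForms g) : LayerThin ![g] := by
  sorry

/-- **First lemma (the flagship instance, over a vendored fact).**  DFI 1995 Proposition 1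
(`dukeFriedlanderIwaniec1995_proposition1`, level-`d` linear forms for `aX² + 2bX + c`,
`ac − b² > 0`, uniform in `h ≤ C₂ d M`, `d ≤ C₁ M`) gives the crux for `n² + 1`
(`a = 1, b = 0, c = 1`). -/
theorem layerThin_X_sq_add_one
    (H : Literature.NumberTheory.Sieve.dukeFriedlanderIwaniec1995_proposition1) :
    LayerThin ![(X ^ 2 + 1 : ℤ[X])] := by
  sorry

/-- **Warm-up of the same line (provable now, no distribution fact): all-linear systems.**
For a Bateman–Horn system of LINEAR polynomials the layer is thin — the relaxed large factor
`m ≤ (a x + b)^{1/2} x^{δ}` keeps every modulus below `x^{0.6}`, so Type-I is trivial and only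
`fundamental_lemma_uniform_holds` (dimension `k + 1`) and `∑_{m ∈ W} 1/m ≍ δ log x` are used. -/
theorem layerThin_of_linear {k : ℕ} (f : Fin k → ℤ[X]) (hlin : ∀ i, (f i).natDegree = 1)
    (hf : Literature.NumberTheory.Sieve.IsBatemanHornSystem f) : LayerThin f := by
  sorry

/-- **System form of the input (degree ≤ 2 systems).**  Shift-uniform level-`e` linear forms:
the same power saving for every shifted quadratic `g(a' + d'X)`, with polynomial loss in `d'`
(needed to carry the other coordinates `f_j`, `j ≠ i`, as passive sieve dimensions through
residue classes `n ≡ a' (mod d')`, `d' ≤ x^{c}`). -/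
def ShiftUniformLevelLinearForms (g : ℤ[X]) : Prop :=
  ∃ A θ K : ℝ, 0 < θ ∧ ∀ (d' : ℕ) (a' : ℤ) (h : ℤ) (e : ℕ) (M : ℝ),
    1 ≤ d' → h ≠ 0 → 1 ≤ e → (e : ℝ) ≤ M →
    ‖Literature.NumberTheory.Sieve.DFI1995.linearForm (g.comp (C a' + C (d' : ℤ) * X)) h e M‖ ≤
      K * ((|h| : ℝ) * e * d') ^ A * M ^ (1 - θ)

/-- **Target of the line for degree ≤ 2** (everything the lever can reach): every Bateman–Horn
system all of whose coordinates have degree ≤ 2, and whose quadratic coordinates satisfy the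
shift-uniform linear-form bound, has a thin layer. -/
theorem layerThin_of_degree_le_two {k : ℕ} (f : Fin k → ℤ[X])
    (hdeg : ∀ i, (f i).natDegree ≤ 2)
    (hf : Literature.NumberTheory.Sieve.IsBatemanHornSystem f)
    (H : ∀ i, (f i).natDegree = 2 → ShiftUniformLevelLinearForms (f i)) : LayerThin f := by
  sorry

end Summit.Parity.BatemanHorn.Cruxes.BalancedSemiprimeLayer.Ideas
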